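import Summits.AtomisticToContinuum.Crystallization.Theorems.GappedShellCensusRadialDefectsVanishOfPalmCruxes

/-!
# Line `palm-pinned-scale` — skeleton rev 2 (lead c1) for crux `GappedShellCensus.RadialDefectsVanish`
(item stmt-AtomisticToContinuum-15930, route `GappedShellCensus`, rank 3)

Everything this line owns has LANDED in the tree (crux-strategist s1 authored, lead c1 landed,
2026-08-17):

* `stub_hcpRootRadial` (pure hcp root geometry at the pinned scale `a₀ = 50/51`) — p135297,
  `Theorems/GappedShellCensusRadialDefectsVanishHcpRootRadial.lean`;
* `stub_returnRadial` (portmanteau return of the measure-level radial predicate with slack to all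
  but `o(N)` particles, `Tendsto` form) — p135308,
  `Theorems/GappedShellCensusRadialDefectsVanishReturnRadial.lean`;
* the registered composition `RadialDefectsVanish_of_palmCruxes :
  MinimiserShells → LayeredLawsSelectHcp → RadialDefectsVanish` (def-free) with
  `palmRigidity_of_hubCruxes`, `minimisingLaws_rootGappedTwelve_of_hubCruxes`,
  `tendsto_radialBad_of_hubCruxes` — p135503,
  `Theorems/GappedShellCensusRadialDefectsVanishOfPalmCruxes.lean` (imported here).

The ONLY open inputs are the two shared hub cruxes of route `PalmUnimodularRigidity`, entered below
BY NAME as the registered stubs `stub_minimiserShells` (= item stmt-AtomisticToContinuum-9225,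
open-problem grade) and `stub_layeredLawsSelectHcp` (= item stmt-AtomisticToContinuum-9226, XL,
staffed).  Terminal state of the lead: `blocked-on: stmt-AtomisticToContinuum-9225` (∧ 9226); the
day both land, `RadialDefectsVanish_of_palmCruxes MinimiserShells_holds LayeredLawsSelectHcp_holds`
closes the crux (one-line Theorems file `--workitem stmt-AtomisticToContinuum-15930`).

Radial fallback (stacking-blind, needed only if 9226 is refuted substantively): line `Sketch`'s
landed transfer `radialDefectsVanish_of_torusRigidity` / `radialDefectsVanish_of_seqTorusRigidity`
(`Theorems/GappedShellCensusRadialDefectsVanishOfTorusRigidity.lean`, p134542) from the torus core,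
or the palm card's selection-free Palm scale lock.  The strategist's full checked skeleton (with the
proofs now landed and the definitional read-backs) is preserved in the ledger evidence of the item
(`line-palm-pinned-scale.lean`, 2026-08-17T01:00Z).
-/

noncomputable section

namespace Summit.AtomisticToContinuum.Crystallization.Theorems.RadialDefectsVanishPalmPinnedScale

open Summit.AtomisticToContinuum.Crystallization.Theses.PalmUnimodularRigidity
  (MinimiserShells LayeredLawsSelectHcp)

/-! ## The registered stubs = the two hub cruxes BY NAME -/

/-- **STUB (= item stmt-AtomisticToContinuum-9225, shared crux `MinimiserShells`, OPEN-PROBLEM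
grade)**: measure-level local structure of minimising point-stationary hard-core laws (close-packed
root shell a.s.). Not attacked by this line; discharged by `MinimiserShells_holds` when it lands. -/
theorem stub_minimiserShells : MinimiserShells := by
  sorry

/-- **STUB (= item stmt-AtomisticToContinuum-9226, shared crux `LayeredLawsSelectHcp`, XL,
staffed)**: selection and rigidity in density form. Not attacked by this line; discharged by
`LayeredLawsSelectHcp_holds` when it lands. -/
theorem stub_layeredLawsSelectHcp : LayeredLawsSelectHcp := by
  sorry

/-! ## Composition: the crux BY NAME -/

/-- **SKELETON THEOREM — the crux `GappedShellCensus.RadialDefectsVanish` BY NAME**: the landed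
conditional composition applied to the two hub stubs. -/
theorem RadialDefectsVanish_of :
    Summit.AtomisticToContinuum.Crystallization.Theses.GappedShellCensus.RadialDefectsVanish :=
  RadialDefectsVanish_of_palmCruxes stub_minimiserShells stub_layeredLawsSelectHcp

end Summit.AtomisticToContinuum.Crystallization.Theorems.RadialDefectsVanishPalmPinnedScale

end
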